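import Mathlib
import Literature.NumberTheory.Automorphic.ResGLnHermitianCone
import Summits.Langlands.Langlands.Theorems.IrreducibilityBySelfDualityHeckeEigenvalueFieldStubConeModel
import HarnessLib

/-!
# Crux `HeckeEigenvalueField` (stmt-Langlands-13632), line `Sketch` — stub CONV `stub_gauge_conv`

Namespace `Summit.Langlands.Langlands.Theorems.HeckeEigenvalueField.Res`.  Theorems only.

On the cone `posCone n K` of self-adjoint matrices over `K_∞ = ℝ^{r₁} × ℂ^{r₂}` positive definite at
every place (`Literature/NumberTheory/Automorphic/ResGLnHermitianCone.lean`), the ENTRY gauge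
`E(H) = 1 + ∑_{i,j} (‖H_ij‖ + ‖(H⁻¹)_ij‖)` and any cone gauge `sz ≥ 1` with (a) the entries of `H` and
`H⁻¹` bounded by `sz H` and (b) `sz(g gᴴ) ≤ C (1 + ∑ (‖g_ij‖ + ‖(g⁻¹)_ij‖))^k`, are polynomially
equivalent: `E ≤ (1 + 2n²) sz` from (a), and, writing `H = g gᴴ` (`stub_coneModel`, transitivity),
`‖g_ij‖², ‖(g⁻¹)_ij‖² ≤ E(H)` place by place (`(g gᴴ)_ii = ∑_l |g_il|²`, `((g⁻¹)ᴴ g⁻¹)_jj = ∑_l |g⁻¹_lj|²`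
and `(g⁻¹)ᴴ g⁻¹ = H⁻¹`), so that (b) gives `sz ≤ |C| (1 + 2n²)^k E^k`.  Elementary.
References: A. Borel, *Introduction aux groupes arithmétiques* (1969), §12 [Borel1969].
-/

set_option linter.dupNamespace false -- project-wide: `Summit.Langlands.Langlands` is the mandated namespace

noncomputable section

open scoped Matrix ComplexOrder Classical
open NumberField NumberField.mixedEmbedding Literature.NumberTheory.Automorphic

namespace Summit.Langlands.Langlands.Theorems.HeckeEigenvalueField.Res

namespace GaugeConv

/-! ### One place: rows of `G Gᴴ` and columns of `Gᴴ G` over `ℝ` or `ℂ` -/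

/-- Over `𝕜 = ℝ` or `ℂ`: `|G i j|² ≤ |(G Gᴴ) i i| = ∑_l |G i l|²`. [folklore] -/
theorem norm_sq_le_norm_mul_conjTranspose_apply {𝕜 : Type*} [RCLike 𝕜] {m : Type*} [Fintype m]
    (G : Matrix m m 𝕜) (i j : m) : ‖G i j‖ ^ 2 ≤ ‖(G * Gᴴ) i i‖ := by
  have h : (G * Gᴴ) i i = ((∑ l, ‖G i l‖ ^ 2 : ℝ) : 𝕜) := by
    rw [Matrix.mul_apply, RCLike.ofReal_sum]
    refine Finset.sum_congr rfl fun l _ => ?_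
    rw [Matrix.conjTranspose_apply, RCLike.star_def, RCLike.mul_conj, RCLike.ofReal_pow]
  rw [h, RCLike.norm_ofReal, abs_of_nonneg (Finset.sum_nonneg fun l _ => sq_nonneg ‖G i l‖)]
  exact Finset.single_le_sum (f := fun l => ‖G i l‖ ^ 2) (fun l _ => sq_nonneg ‖G i l‖)
    (Finset.mem_univ j)

/-- Over `𝕜 = ℝ` or `ℂ`: `|G i j|² ≤ |(Gᴴ G) j j| = ∑_l |G l j|²`. [folklore] -/
theorem norm_sq_le_norm_conjTranspose_mul_apply {𝕜 : Type*} [RCLike 𝕜] {m : Type*} [Fintype m]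
    (G : Matrix m m 𝕜) (i j : m) : ‖G i j‖ ^ 2 ≤ ‖(Gᴴ * G) j j‖ := by
  have h : (Gᴴ * G) j j = ((∑ l, ‖G l j‖ ^ 2 : ℝ) : 𝕜) := by
    rw [Matrix.mul_apply, RCLike.ofReal_sum]
    refine Finset.sum_congr rfl fun l _ => ?_
    rw [Matrix.conjTranspose_apply, RCLike.star_def, RCLike.conj_mul, RCLike.ofReal_pow]
  rw [h, RCLike.norm_ofReal, abs_of_nonneg (Finset.sum_nonneg fun l _ => sq_nonneg ‖G l j‖)]
  exact Finset.single_le_sum (f := fun l => ‖G l j‖ ^ 2) (fun l _ => sq_nonneg ‖G l j‖)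
    (Finset.mem_univ i)

/-! ### Over `K_∞`: entries of a square root `g` of `H = g gᴴ` and of `g⁻¹` -/

variable {n : ℕ} {K : Type} [Field K] [NumberField K]

/-- **At one place** `φ : K_∞ → 𝕜` (a `*`-preserving ring homomorphism): the `φ`-component of an entry
`g i j` has square at most `‖(g gᴴ) i i‖` and at most `‖(gᴴ g) j j‖`. [folklore] -/
theorem norm_place_sq_le {𝕜 : Type*} [RCLike 𝕜] (φ : mixedSpace K →+* 𝕜)
    (hφs : ∀ a : mixedSpace K, φ (star a) = star (φ a)) (hφn : ∀ a : mixedSpace K, ‖φ a‖ ≤ ‖a‖)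
    (g : Matrix (Fin n) (Fin n) (mixedSpace K)) (i j : Fin n) :
    ‖φ (g i j)‖ ^ 2 ≤ ‖(g * gᴴ) i i‖ ∧ ‖φ (g i j)‖ ^ 2 ≤ ‖(gᴴ * g) j j‖ := by
  refine ⟨?_, ?_⟩
  · calc ‖φ (g i j)‖ ^ 2 = ‖(g.map φ) i j‖ ^ 2 := rfl
      _ ≤ ‖(g.map φ * (g.map φ)ᴴ) i i‖ := norm_sq_le_norm_mul_conjTranspose_apply _ i j
      _ = ‖φ ((g * gᴴ) i i)‖ := by rw [← Matrix.conjTranspose_map φ hφs, ← Matrix.map_mul]; rfl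
      _ ≤ ‖(g * gᴴ) i i‖ := hφn _
  · calc ‖φ (g i j)‖ ^ 2 = ‖(g.map φ) i j‖ ^ 2 := rfl
      _ ≤ ‖((g.map φ)ᴴ * g.map φ) j j‖ := norm_sq_le_norm_conjTranspose_mul_apply _ i j
      _ = ‖φ ((gᴴ * g) j j)‖ := by rw [← Matrix.conjTranspose_map φ hφs, ← Matrix.map_mul]; rfl
      _ ≤ ‖(gᴴ * g) j j‖ := hφn _

/-- A norm bound in `K_∞ = ℝ^{r₁} × ℂ^{r₂}` (sup norm) is checked place by place. [folklore] -/
theorem norm_le_of_forall_place (a : mixedSpace K) {r : ℝ} (hr : 0 ≤ r)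
    (h₁ : ∀ w, ‖mixedSpaceEvalReal K w a‖ ≤ r) (h₂ : ∀ w, ‖mixedSpaceEvalComplex K w a‖ ≤ r) :
    ‖a‖ ≤ r := by
  rw [Prod.norm_def, max_le_iff, pi_norm_le_iff_of_nonneg hr, pi_norm_le_iff_of_nonneg hr]
  exact ⟨fun w => h₁ w, fun w => h₂ w⟩

/-- **Entries of `g` and of `gᴴ`-columns against `E ≥ 1`**: if `‖(g gᴴ) i i‖ ≤ E` then `‖g i j‖ ≤ E`,
and if `‖(gᴴ g) j j‖ ≤ E` then `‖g i j‖ ≤ E`. [folklore] -/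
theorem norm_apply_le_of_diag_le (g : Matrix (Fin n) (Fin n) (mixedSpace K))
    (i j : Fin n) {E : ℝ} (hE : 1 ≤ E) :
    (‖(g * gᴴ) i i‖ ≤ E → ‖g i j‖ ≤ E) ∧ (‖(gᴴ * g) j j‖ ≤ E → ‖g i j‖ ≤ E) := by
  have hR := fun w => norm_place_sq_le (mixedSpaceEvalReal K w) (fun _ => rfl)
    (fun a => (norm_le_pi_norm a.1 w).trans (norm_fst_le a)) g i j
  have hC := fun w => norm_place_sq_le (mixedSpaceEvalComplex K w) (fun _ => rfl)
    (fun a => (norm_le_pi_norm a.2 w).trans (norm_snd_le a)) g i j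
  -- `a² ≤ E` and `1 ≤ E` give `a ≤ E` (no square roots: `2a ≤ a² + 1 ≤ 2E`)
  have key : ∀ a : ℝ, a ^ 2 ≤ E → a ≤ E := fun a h => by nlinarith [sq_nonneg (a - 1)]
  refine ⟨fun h => ?_, fun h => ?_⟩
  · exact norm_le_of_forall_place _ (zero_le_one.trans hE)
      (fun w => key _ ((hR w).1.trans h)) (fun w => key _ ((hC w).1.trans h))
  · exact norm_le_of_forall_place _ (zero_le_one.trans hE)
      (fun w => key _ ((hR w).2.trans h)) (fun w => key _ ((hC w).2.trans h))

omit [NumberField K] in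
/-- **Inverse of a hermitian square**: `(g gᴴ)⁻¹ = (g⁻¹)ᴴ g⁻¹` for `g ∈ GL_n(K_∞)`. [folklore] -/
theorem inv_mul_conjTranspose_eq (g : GL (Fin n) (mixedSpace K)) :
    ((g : Matrix (Fin n) (Fin n) (mixedSpace K)) * (g : Matrix (Fin n) (Fin n) (mixedSpace K))ᴴ)⁻¹ =
      ((g⁻¹ : GL (Fin n) (mixedSpace K)) : Matrix (Fin n) (Fin n) (mixedSpace K))ᴴ *
        ((g⁻¹ : GL (Fin n) (mixedSpace K)) : Matrix (Fin n) (Fin n) (mixedSpace K)) := by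
  refine Matrix.inv_eq_left_inv ?_
  rw [Matrix.mul_assoc, ← Matrix.mul_assoc _ (g : Matrix (Fin n) (Fin n) (mixedSpace K)),
    Units.inv_mul, Matrix.one_mul, ← Matrix.conjTranspose_mul, Units.mul_inv, Matrix.conjTranspose_one]

/-- A single term of a double sum of non-negative reals is at most the sum. [folklore] -/
theorem single_le_sum_sum {f : Fin n → Fin n → ℝ} (hf : ∀ i j, 0 ≤ f i j) (i j : Fin n) :
    f i j ≤ ∑ i', ∑ j', f i' j' :=
  (Finset.single_le_sum (f := fun j' => f i j') (fun j' _ => hf i j') (Finset.mem_univ j)).trans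
    (Finset.single_le_sum (f := fun i' => ∑ j', f i' j')
      (fun i' _ => Finset.sum_nonneg fun j' _ => hf i' j') (Finset.mem_univ i))

/-- A double sum over `Fin n × Fin n` of terms `≤ c` is at most `n² c`, and `1 + n² · 2E ≤ (1 + 2n²) E`
for `E ≥ 1`: the bookkeeping step `1 + ∑∑ (a + b) ≤ (1 + 2 n²) E` when `a, b ≤ E`. [folklore] -/
theorem one_add_sum_sum_le {a b : Fin n → Fin n → ℝ} {E : ℝ} (hE : 1 ≤ E)
    (ha : ∀ i j, a i j ≤ E) (hb : ∀ i j, b i j ≤ E) :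
    1 + ∑ i, ∑ j, (a i j + b i j) ≤ (1 + 2 * (n : ℝ) ^ 2) * E := by
  have h : ∑ i, ∑ j, (a i j + b i j) ≤ ∑ _i : Fin n, ∑ _j : Fin n, (E + E) :=
    Finset.sum_le_sum fun i _ => Finset.sum_le_sum fun j _ => add_le_add (ha i j) (hb i j)
  simp only [Finset.sum_const, Finset.card_univ, Fintype.card_fin, nsmul_eq_mul] at h
  nlinarith [h, sq_nonneg (n : ℝ)]

end GaugeConv

open GaugeConv in
/-- **Stub CONV — the entry gauge `E(H) = 1 + ∑ (‖H_ij‖ + ‖(H⁻¹)_ij‖)` and a cone gauge `sz` (as produced by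
the landed GAUGE `stub_exists_coneGauge`: entries of `H`, `H⁻¹` bounded by `sz`, and `sz(g gᴴ)` bounded by a
polynomial in the entries of `g, g⁻¹`) are polynomially equivalent on the positive cone**: `E ≤ 1 + 2n² sz`,
and `sz(H) ≤ C (1 + poly(E(H)))^k` through ANY square root `g` of `H` (`∑ ‖g_ij‖² ≍ tr H`,
`∑ ‖(g⁻¹)_ij‖² ≍ tr H⁻¹`). [folklore] -/
theorem stub_gauge_conv (n : ℕ) (K : Type) [Field K] [NumberField K]
    (sz : ResGLnCone.hermSpace n K → ℝ)
    (hsz1 : ∀ H ∈ ResGLnCone.posCone n K, 1 ≤ sz H)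
    (hsz2 : ∀ H ∈ ResGLnCone.posCone n K, ∀ i j : Fin n,
      ‖(H : Matrix (Fin n) (Fin n) (mixedSpace K)) i j‖ ≤ sz H ∧
        ‖(H : Matrix (Fin n) (Fin n) (mixedSpace K))⁻¹ i j‖ ≤ sz H)
    (hsz5 : ∃ (C : ℝ) (k : ℕ), ∀ (g : GL (Fin n) (mixedSpace K)) (H : ResGLnCone.hermSpace n K),
      H ∈ ResGLnCone.posCone n K →
      (H : Matrix (Fin n) (Fin n) (mixedSpace K)) =
          (g : Matrix (Fin n) (Fin n) (mixedSpace K)) * ((g : Matrix (Fin n) (Fin n) (mixedSpace K)))ᴴ →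
        sz H ≤ C * (1 + ∑ i : Fin n, ∑ j : Fin n,
          (‖(g : Matrix (Fin n) (Fin n) (mixedSpace K)) i j‖ +
            ‖((g⁻¹ : GL (Fin n) (mixedSpace K)) : Matrix (Fin n) (Fin n) (mixedSpace K)) i j‖)) ^ k) :
    ∃ (C : ℝ) (k : ℕ), ∀ x ∈ ResGLnCone.posCone n K,
      (1 + ∑ i, ∑ j,
            (‖(x : Matrix (Fin n) (Fin n) (mixedSpace K)) i j‖ +
              ‖(x : Matrix (Fin n) (Fin n) (mixedSpace K))⁻¹ i j‖)) ≤ C * sz x ^ k ∧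
      sz x ≤ C * (1 + ∑ i, ∑ j,
            (‖(x : Matrix (Fin n) (Fin n) (mixedSpace K)) i j‖ +
              ‖(x : Matrix (Fin n) (Fin n) (mixedSpace K))⁻¹ i j‖)) ^ k := by
  obtain ⟨C₀, k₀, h5⟩ := hsz5
  -- the constants: `A = 1 + 2n² ≥ 1`, `C = (1 + |C₀|) A^(k₀+1)`, `k = k₀ + 1`
  set A : ℝ := 1 + 2 * (n : ℝ) ^ 2 with hA_def
  have hA1 : 1 ≤ A := by rw [hA_def]; nlinarith [sq_nonneg (n : ℝ)]
  have hA0 : 0 ≤ A := zero_le_one.trans hA1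
  refine ⟨(1 + |C₀|) * A ^ (k₀ + 1), k₀ + 1, fun x hx => ?_⟩
  set X : Matrix (Fin n) (Fin n) (mixedSpace K) := (x : Matrix (Fin n) (Fin n) (mixedSpace K)) with hX_def
  set E : ℝ := 1 + ∑ i, ∑ j, (‖X i j‖ + ‖X⁻¹ i j‖) with hE_def
  have hS0 : 0 ≤ ∑ i, ∑ j, (‖X i j‖ + ‖X⁻¹ i j‖) :=
    Finset.sum_nonneg fun i _ => Finset.sum_nonneg fun j _ => add_nonneg (norm_nonneg _) (norm_nonneg _)
  have hE1 : 1 ≤ E := by rw [hE_def]; linarith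
  have hE0 : 0 ≤ E := zero_le_one.trans hE1
  have hsx1 : 1 ≤ sz x := hsz1 x hx
  have hsx0 : 0 ≤ sz x := zero_le_one.trans hsx1
  have hC₀ : 0 ≤ 1 + |C₀| := by positivity
  have hAk1 : 1 ≤ A ^ (k₀ + 1) := one_le_pow₀ hA1
  refine ⟨?_, ?_⟩
  · -- (1) `E ≤ A · sz x ≤ C · (sz x)^(k₀+1)`
    have h1 : E ≤ A * sz x :=
      one_add_sum_sum_le hsx1 (fun i j => (hsz2 x hx i j).1) (fun i j => (hsz2 x hx i j).2)
    calc E ≤ A * sz x := h1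
      _ ≤ ((1 + |C₀|) * A ^ (k₀ + 1)) * sz x ^ (k₀ + 1) := by
          refine mul_le_mul ?_ (le_self_pow₀ hsx1 (Nat.succ_ne_zero k₀)) hsx0 (by positivity)
          calc A ≤ A ^ (k₀ + 1) := le_self_pow₀ hA1 (Nat.succ_ne_zero k₀)
            _ ≤ (1 + |C₀|) * A ^ (k₀ + 1) :=
                le_mul_of_one_le_left (zero_le_one.trans hAk1) (by linarith [abs_nonneg C₀])
  · -- (2) a square root `g` of `x` (transitivity of the cone), `hsz5`, and the entry bounds
    obtain ⟨g, hg⟩ := (stub_coneModel n K).1 X hx.1 hx.2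
    set G : Matrix (Fin n) (Fin n) (mixedSpace K) := (g : Matrix (Fin n) (Fin n) (mixedSpace K)) with hG_def
    set Gi : Matrix (Fin n) (Fin n) (mixedSpace K) :=
      ((g⁻¹ : GL (Fin n) (mixedSpace K)) : Matrix (Fin n) (Fin n) (mixedSpace K)) with hGi_def
    have h5x : sz x ≤ C₀ * (1 + ∑ i, ∑ j, (‖G i j‖ + ‖Gi i j‖)) ^ k₀ := h5 g x hx hg.symm
    -- entries of `x` and `x⁻¹` against `E`
    have hxE : ∀ i j, ‖X i j‖ ≤ E ∧ ‖X⁻¹ i j‖ ≤ E := by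
      intro i j
      have h := single_le_sum_sum (f := fun i j => ‖X i j‖ + ‖X⁻¹ i j‖)
        (fun i j => add_nonneg (norm_nonneg _) (norm_nonneg _)) i j
      have h' : ‖X i j‖ + ‖X⁻¹ i j‖ ≤ E := by rw [hE_def]; linarith
      exact ⟨by linarith [norm_nonneg (X⁻¹ i j)], by linarith [norm_nonneg (X i j)]⟩
    -- `x⁻¹ = Giᴴ Gi`
    have hXinv : X⁻¹ = Giᴴ * Gi := by rw [← hg]; exact inv_mul_conjTranspose_eq g
    -- entries of `g` and `g⁻¹` against `E`
    have hGE : ∀ i j, ‖G i j‖ ≤ E := fun i j =>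
      (norm_apply_le_of_diag_le G i j hE1).1 (hg ▸ (hxE i i).1)
    have hGiE : ∀ i j, ‖Gi i j‖ ≤ E := fun i j =>
      (norm_apply_le_of_diag_le Gi i j hE1).2 (hXinv ▸ (hxE j j).2)
    have hS : 1 + ∑ i, ∑ j, (‖G i j‖ + ‖Gi i j‖) ≤ A * E := one_add_sum_sum_le hE1 hGE hGiE
    have hS0' : 0 ≤ 1 + ∑ i, ∑ j, (‖G i j‖ + ‖Gi i j‖) := by
      have := Finset.sum_nonneg fun i (_ : i ∈ Finset.univ) =>
        Finset.sum_nonneg fun j (_ : j ∈ Finset.univ) => add_nonneg (norm_nonneg (G i j)) (norm_nonneg (Gi i j))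
      linarith
    calc sz x ≤ C₀ * (1 + ∑ i, ∑ j, (‖G i j‖ + ‖Gi i j‖)) ^ k₀ := h5x
      _ ≤ |C₀| * (1 + ∑ i, ∑ j, (‖G i j‖ + ‖Gi i j‖)) ^ k₀ :=
          mul_le_mul_of_nonneg_right (le_abs_self C₀) (pow_nonneg hS0' k₀)
      _ ≤ |C₀| * (A * E) ^ k₀ :=
          mul_le_mul_of_nonneg_left (pow_le_pow_left₀ hS0' hS k₀) (abs_nonneg C₀)
      _ = (|C₀| * A ^ k₀) * E ^ k₀ := by rw [mul_pow, mul_assoc]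
      _ ≤ ((1 + |C₀|) * A ^ (k₀ + 1)) * E ^ (k₀ + 1) := by
          refine mul_le_mul (mul_le_mul (by linarith [abs_nonneg C₀])
            (pow_le_pow_right₀ hA1 (Nat.le_succ k₀)) (pow_nonneg hA0 k₀) hC₀)
            (pow_le_pow_right₀ hE1 (Nat.le_succ k₀)) (pow_nonneg hE0 k₀) (by positivity)

end Summit.Langlands.Langlands.Theorems.HeckeEigenvalueField.Res

end
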